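import Literature.AlgebraicGeometry.Frobenioids.BirationalizationCategoryTheoreticity
import Literature.AlgebraicGeometry.Frobenioids.DivisorMonoidBirationalPerfectProofs
import HarnessLib

/-!
# Frobenioids I, toward Corollary 4.11 (ii): `Ψ^birat` preserves base-isomorphisms

Mochizuki, *The geometry of Frobenioids I: the general theory*, Kyushu J. Math. **62** (2008)
293–400, §4, proof of Corollary 4.11 (ii), kurims text p. 93 (the sentence following "[cf. Corollary
4.10]") [cite: MochizukiFrdI2008, Cor. 4.11 (ii) p.93]:
"Since, moreover, the base-isomorphisms of `C_i^birat` are precisely the morphisms of `C_i^birat` which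
are abstractly equivalent to morphisms that arise from base-isomorphisms of `C_i` [cf. Proposition 4.4,
(iv)], it follows that `Ψ^birat` preserves base-isomorphisms, hence also pull-back morphisms
[cf. Proposition 1.7, (ii)]."
(Docstring v2: the header quotation re-quoted verbatim with the printed brackets — referee pass C8,
finding C8-F8; v1 carried a recomposed paraphrase inside quotation marks. Outside the quotation: the
hypothesis that `Ψ` preserves base-isomorphisms, which the printed argument draws from Theorem 3.4 (iii),
enters below as the explicit binder `hbi`; declarations unchanged.)

PROOF-ONLY piece (theorems only) for abc-iut-L1-d6's sub-DAG S2 (Cor. 4.11, lemma L10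
`birat_preserves_baseIso`), over abc-iut-L1-t10's `Birat.mapOfEquiv` / `Birat.mapOfEquivFac`
(`BirationalizationCategoryTheoreticity.lean`: `Ψ^birat` and the 1-commutative square of Cor. 4.10 at
THE birationalizations) and this seat's fraction calculus (`DivisorMonoidBirationalPerfectProofs.lean`:
every morphism of `C^birat` is `(α^birat)⁻¹ ≫ φ′^birat`, and it is a base-isomorphism iff `φ′` is):

* `Birat.isBaseIso_mapOfEquiv_map_toBirat_map` — `Ψ^birat` of the image of a base-isomorphism of `C₁` is a
  base-isomorphism of `C₂^birat`, if `Ψ` preserves base-isomorphisms (the Thm. 3.4 (iii) input, as the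
  explicit hypothesis `hbi : PreservesMor Ψ.functor (ofFunctor Φ₁ F₁).IsBaseIso (ofFunctor Φ₂ F₂).IsBaseIso`,
  abc-iut-L1-d6's exact binder): by the square, `Ψ^birat(φ^birat) ≅ (Ψ φ)^birat` up to isomorphisms;
* `Birat.isBaseIso_mapOfEquiv_map` — **`Ψ^birat` preserves base-isomorphisms** of `C₁^birat`.

Seat abc-iut-L6-t20 (abc-iut cell; PIECE offered to the S2 holder abc-iut-L1-d6). No statement of the
paper is strengthened; nothing here concerns the disputed parts of IUT.
-/

namespace Literature.AlgebraicGeometry.Frobenioids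

open CategoryTheory

universe w₁ v₁ v₁' u₁ u₁' w₂ v₂ v₂' u₂ u₂'

namespace PreFrobenioid

namespace Birat

variable {D₁ : Type u₁} [Category.{v₁} D₁] {Φ₁ : D₁ᵒᵖ ⥤ CommMonCat.{w₁}}
  {C₁ : Type u₁'} [Category.{v₁'} C₁] {F₁ : C₁ ⥤ ElemFrobenioid Φ₁}
  {D₂ : Type u₂} [Category.{v₂} D₂] {Φ₂ : D₂ᵒᵖ ⥤ CommMonCat.{w₂}}
  {C₂ : Type u₂'} [Category.{v₂'} C₂] {F₂ : C₂ ⥤ ElemFrobenioid Φ₂}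
  (hF₁ : IsFrobenioid F₁) (hsq₁ : HasBiratSquares F₁) (hF₂ : IsFrobenioid F₂) (hsq₂ : HasBiratSquares F₂)
  (Ψ : C₁ ≌ C₂)
  (hΨ : ∀ ⦃A B : C₁⦄ (f : A ⟶ B), IsCoAngularPreStep F₁ f → IsCoAngularPreStep F₂ (Ψ.functor.map f))
  (hbi : PreFrobenioidData.PreservesMor Ψ.functor (PreFrobenioidData.ofFunctor Φ₁ F₁).IsBaseIso
    (PreFrobenioidData.ofFunctor Φ₂ F₂).IsBaseIso)

include hbi

/-- If `Ψ` preserves base-isomorphisms of `C₁` (Thm. 3.4 (iii)), then `Ψ^birat` carries the image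
`φ^birat` of a base-isomorphism `φ` of `C₁` to a base-isomorphism of `C₂^birat`: by the 1-commutative
square of Cor. 4.10, `Ψ^birat(φ^birat) = e ≫ (Ψ φ)^birat ≫ e′` with `e, e′` isomorphisms.
[cite: MochizukiFrdI2008, Cor. 4.11 (ii) p.93] -/
theorem isBaseIso_mapOfEquiv_map_toBirat_map {A B : C₁} (φ : A ⟶ B) (hφ : IsBaseIso F₁ φ) :
    IsBaseIso (toElemZero hF₂ hsq₂)
      ((mapOfEquiv hF₁ hsq₁ hF₂ hsq₂ Ψ hΨ).map ((toBirat F₁ hF₁ hsq₁).map φ)) := by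
  let e := mapOfEquivFac hF₁ hsq₁ hF₂ hsq₂ Ψ hΨ
  haveI : IsIso (e.hom.app A) := ⟨⟨e.inv.app A, e.hom_inv_id_app A, e.inv_hom_id_app A⟩⟩
  haveI : IsIso (e.inv.app B) := ⟨⟨e.hom.app B, e.inv_hom_id_app B, e.hom_inv_id_app B⟩⟩
  have hA : IsBaseIso (toElemZero hF₂ hsq₂) (e.hom.app A) :=
    isBaseIso_of_isIso (toElemZero hF₂ hsq₂) (e.hom.app A)
  have hB : IsBaseIso (toElemZero hF₂ hsq₂) (e.inv.app B) :=
    isBaseIso_of_isIso (toElemZero hF₂ hsq₂) (e.inv.app B)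
  have nat := e.hom.naturality φ
  have h1 : (mapOfEquiv hF₁ hsq₁ hF₂ hsq₂ Ψ hΨ).map ((toBirat F₁ hF₁ hsq₁).map φ) =
      ((toBirat F₁ hF₁ hsq₁ ⋙ mapOfEquiv hF₁ hsq₁ hF₂ hsq₂ Ψ hΨ).map φ ≫ e.hom.app B) ≫
        e.inv.app B := by
    simp only [Functor.comp_map, Category.assoc, Iso.hom_inv_id_app, Category.comp_id]
  rw [h1, nat]
  exact IsBaseIso.comp (toElemZero hF₂ hsq₂)
    (IsBaseIso.comp (toElemZero hF₂ hsq₂) hA (isBaseIso_toElemZero_map (hbi φ hφ))) hB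

/-- **`Ψ^birat` preserves base-isomorphisms** (proof of Cor. 4.11 (ii), p. 93 ll.31–35), for morphisms
between objects `A^birat`: a base-isomorphism `g = [(α, φ′)] = (α^birat)⁻¹ ≫ φ′^birat` of `C₁^birat` has
`φ′` a base-isomorphism of `C₁`, and `Ψ^birat g = (Ψ^birat α^birat)⁻¹ ≫ Ψ^birat φ′^birat`.
[cite: MochizukiFrdI2008, Cor. 4.11 (ii) p.93] -/
theorem isBaseIso_mapOfEquiv_map_of {A B : C₁}
    (g : (toBirat F₁ hF₁ hsq₁).obj A ⟶ (toBirat F₁ hF₁ hsq₁).obj B)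
    (hg : IsBaseIso (toElemZero hF₁ hsq₁) g) :
    IsBaseIso (toElemZero hF₂ hsq₂) ((mapOfEquiv hF₁ hsq₁ hF₂ hsq₂ Ψ hΨ).map g) := by
  obtain ⟨f, rfl⟩ := exists_homMk_eq g
  have hnum : IsBaseIso F₁ f.num := isBaseIso_num f hg
  haveI := toBirat_inverts hF₁ hsq₁ f.den f.den_mem
  rw [homMk_eq_inv_comp f, Functor.map_comp, Functor.map_inv]
  exact IsBaseIso.comp (toElemZero hF₂ hsq₂) (isBaseIso_of_isIso (toElemZero hF₂ hsq₂) _)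
    (isBaseIso_mapOfEquiv_map_toBirat_map hF₁ hsq₁ hF₂ hsq₂ Ψ hΨ hbi f.num hnum)

/-- **`Ψ^birat` preserves base-isomorphisms** of `C₁^birat` (all objects of `C^birat` being `A^birat`).
[cite: MochizukiFrdI2008, Cor. 4.11 (ii) p.93] -/
theorem isBaseIso_mapOfEquiv_map {X Y : Birat F₁ hF₁ hsq₁} (g : X ⟶ Y)
    (hg : IsBaseIso (toElemZero hF₁ hsq₁) g) :
    IsBaseIso (toElemZero hF₂ hsq₂) ((mapOfEquiv hF₁ hsq₁ hF₂ hsq₂ Ψ hΨ).map g) :=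
  isBaseIso_mapOfEquiv_map_of hF₁ hsq₁ hF₂ hsq₂ Ψ hΨ hbi (A := X.out) (B := Y.out) g hg

end Birat

end PreFrobenioid

end Literature.AlgebraicGeometry.Frobenioids
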